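import Summits.Ventures.CertifiedQuantumChemistry.Rows.HubbardRingTVVacuumSector
import Summits.Ventures.CertifiedQuantumChemistry.Rows.OneBodySectorExactness
import HarnessLib

/-!
# Ventures/CertifiedQuantumChemistry — Rows/OneElectronSectorsExact.lean: the level-DQG programme is EXACT
# in every ONE-ELECTRON sector of every symmetric model (any two-body table), and — by the ring's
# particle–hole duality — in the one-HOLE sectors of every TV-H ring

HONEST FRAMING (verbatim): certified bounds for a stated model Hamiltonian in a stated basis; not a
claim about the real molecule beyond that model.

Seat rdm-B, ROWS courtesy file (theorems only; no `def`, no notation, no instance; zero compute). With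
gen 38's `Rows/HubbardRingTVVacuumSector.lean` (`N = 0`, `N = 2L`), this gen's
`Rows/TwoElectronSectorsExact.lean` (`N = 2`, `N = 2k − 2`) and the present file (`N = 1`; on the rings
also `N = 2L − 1`) the three outermost fillings at each end of the range are typed as EXACT for the
cell's level-DQG programme — the relaxation gap of S-U lives strictly inside. The one-electron case is
elementary and seems not to be spelled out in the tree's Literature files (`OneBodyRelaxationExactness`
needs `g = 0`; `TwoElectronRelaxationExactness` needs `N = 2`): at `N = 1` the contraction row
`Σ_j Γ_{(i,j),(k,j)} = (N − 1)·γ_{ik}` and `Γ ⪰ 0` force `Γ = 0` on EVERY DQG-feasible pair, so the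
functional does not see the two-body table; likewise a unit one-electron VECTOR has `²D = 0` (its RDM
pair is feasible, Mazziotti's necessity), so its energy does not see it either; at `g = 0` the sector
programme is exact by the bathtub / Fermi-sum theorem (`Rows/OneBodySectorExactness.lean`).

* §1 `OneElectron.two_eq_zero` (`IsDQGFeasible N γ Γ`, `N = 1` ⇒ `Γ = 0`), `rdmEnergy_two_zero`,
  `rdmEnergy_eq_of_one`, **`pqgSectorEnergy_eq_of_add_eq_one`** (`E_PQG^{h,g}(a, b) = E_PQG^{h,g′}(a, b)`
  for `a + b = 1`).
* §2 `twoRDM_eq_zero` (unit vector of a one-electron sector), `expect_eq_of_add_eq_one`,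
  **`sectorGroundEnergy_eq_of_add_eq_one`** (`E₀(Ĥ(h,g); a, b) = E₀(Ĥ(h,g′); a, b)`, `a + b = 1`).
* §3 **`pqgSectorEnergy_eq_sectorGroundEnergy_of_add_eq_one`** — `E_PQG(a, b) = E₀(Ĥ; a, b)` for
  `a + b = 1`, Hermitian `h`, real `h_nuc`, ANY `g`, `a, b ≤ |Λ|`.
* §4 the cell's objects: **`Model.pqgSectorEnergy_eq_energy_of_add_eq_one`** (every symmetric model);
  `hubbardRingTV_pqgSectorEnergy_eq_energy_oneElectron` (`(1,0)`, `(0,1)` on every ring `L ≥ 1`);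
  **`hubbardRingTV_pqgSectorEnergy_eq_energy_oneHole`** (`(L−1, L)`, `(L, L−1)`: gen 38's
  `hubbardRingTV_{energy,pqgSectorEnergy}_particleHole` transport the one-electron statement at hopping
  `−t`, the two sides shifting by the same `U·(L − 1)`).

READING: statements about VALUES of the abstract programme; nothing here is a certificate, a row or a
value of record. All PROVED (0 sorry, standard axioms); no defs, no named facts. References
(docstring-only): D. A. Mazziotti, Adv. Chem. Phys. 134 (2007) ch. 3 §II.B eq. (16) (contraction),
§II.E; A. J. Coleman, Rev. Mod. Phys. 35 (1963) 668. Tree (REUSED):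
`VacuumSector.eq_zero_of_posSemidef_of_diag_eq_zero` (gen 38), `IsDQGFeasible.of_state`, `rdmEnergy_rdm`,
`mem_szSector_iff_isInSector`, `sectorGroundEnergy_def`, `Matrix.minEnergyOn`,
`pqgSectorEnergy_eq_sectorGroundEnergy_oneBody` (rdm-B, `Rows/OneBodySectorExactness.lean`),
`hubbardRingTV_energy_particleHole` / `hubbardRingTV_pqgSectorEnergy_particleHole` (gen 38).
-/

noncomputable section

namespace Summit.Ventures.CertifiedQuantumChemistry

open Matrix Finset
open Literature.MathematicalPhysics.QuantumLattice Literature.MathematicalPhysics.QuantumChemistry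
open Summit.Ventures.CertifiedQuantumChemistry.Hamiltonians
open scoped ComplexOrder

namespace OneElectron

/-! ## §1 At `N = 1` every DQG-feasible two-matrix vanishes; the functional forgets the two-body table -/

section Abstract

variable {Λ : Type*} [LinearOrder Λ] [Fintype Λ]
variable {γ : Matrix (Orb Λ) (Orb Λ) ℂ} {Γ : Matrix (Orb Λ × Orb Λ) (Orb Λ × Orb Λ) ℂ}

/-- **At `N = 1` every DQG-feasible two-matrix vanishes**: the contraction row gives
`Σ_j Γ_{(i,j),(i,j)} = (1 − 1)·γ_{ii} = 0` for every `i`, so the positive-semidefinite `Γ` has zero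
diagonal, hence `Γ = 0` (one electron carries no pairs). [folklore] -/
theorem two_eq_zero {N : ℕ} (hf : IsDQGFeasible N γ Γ) (hN : N = 1) : Γ = 0 := by
  classical
  subst hN
  have hdiag : ∀ P : Orb Λ × Orb Λ, Γ P P = 0 := by
    rintro ⟨i, j⟩
    have hrow : ∑ j' : Orb Λ, Γ (i, j') (i, j') = 0 := by
      rw [hf.contract i i, Nat.cast_one, sub_self, zero_mul]
    have hnn : ∀ j' ∈ (Finset.univ : Finset (Orb Λ)), 0 ≤ Γ (i, j') (i, j') := fun j' _ =>
      hf.d_psd.diag_nonneg (i := (i, j'))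
    exact (Finset.sum_eq_zero_iff_of_nonneg hnn).1 hrow j (Finset.mem_univ j)
  exact VacuumSector.eq_zero_of_posSemidef_of_diag_eq_zero hf.d_psd hdiag

omit [LinearOrder Λ] in
/-- At the zero two-matrix the functional does not see the two-body table:
`E_{h,g}(γ, 0) = E_{h,g′}(γ, 0)` (both are the one-body term plus `h_nuc`). [folklore] -/
theorem rdmEnergy_two_zero (h : Λ → Λ → ℂ) (g g' : Λ → Λ → Λ → Λ → ℂ) (hnuc : ℂ)
    (γ : Matrix (Orb Λ) (Orb Λ) ℂ) :
    rdmEnergy h g hnuc γ 0 = rdmEnergy h g' hnuc γ 0 := by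
  simp [rdmEnergy]

/-- **On a DQG-feasible pair at `N = 1` the functional forgets the two-body table**:
`E_{h,g}(γ, Γ) = E_{h,g′}(γ, Γ)` for all `g, g′`. [folklore] -/
theorem rdmEnergy_eq_of_one (h : Λ → Λ → ℂ) (g g' : Λ → Λ → Λ → Λ → ℂ) (hnuc : ℂ) {N : ℕ}
    (hf : IsDQGFeasible N γ Γ) (hN : N = 1) : rdmEnergy h g hnuc γ Γ = rdmEnergy h g' hnuc γ Γ := by
  rw [two_eq_zero hf hN]
  exact rdmEnergy_two_zero h g g' hnuc γ

/-- **The level-DQG value of a ONE-ELECTRON sector does not depend on the two-body table**: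
`E_PQG^{h,g}(a, b) = E_PQG^{h,g′}(a, b)` for `a + b = 1` (same feasible set, same functional values).
[folklore] -/
theorem pqgSectorEnergy_eq_of_add_eq_one (h : Λ → Λ → ℂ) (g g' : Λ → Λ → Λ → Λ → ℂ) (hnuc : ℂ)
    {a b : ℕ} (hab : a + b = 1) :
    pqgSectorEnergy h g hnuc a b = pqgSectorEnergy h g' hnuc a b := by
  unfold pqgSectorEnergy
  refine congrArg sInf (Set.ext fun E => ⟨?_, ?_⟩)
  · rintro ⟨γ, Γ, hf, rfl⟩
    exact ⟨γ, Γ, hf, by rw [rdmEnergy_eq_of_one h g g' hnuc hf.dqg hab]⟩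
  · rintro ⟨γ, Γ, hf, rfl⟩
    exact ⟨γ, Γ, hf, by rw [rdmEnergy_eq_of_one h g g' hnuc hf.dqg hab]⟩

/-! ## §2 The exact side: a one-electron vector has no two-body energy -/

/-- **The 2-RDM of a unit one-electron vector vanishes** (its RDM pair is DQG-feasible at `N = 1`,
Mazziotti's necessity, and §1). [folklore] -/
theorem twoRDM_eq_zero {a b : ℕ} (hab : a + b = 1) {ψ : Fock (Orb Λ)} (hψ : IsInSector a b ψ)
    (hψ1 : star ψ ⬝ᵥ ψ = 1) : twoRDM ψ = 0 :=
  two_eq_zero (IsDQGFeasible.of_state hψ.isNParticle hψ1) hab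

/-- **A unit one-electron vector has the same energy for every two-body table**:
`⟨ψ, Ĥ(h, g, h_nuc) ψ⟩ = ⟨ψ, Ĥ(h, g′, h_nuc) ψ⟩` (`a + b = 1`). [folklore] -/
theorem expect_eq_of_add_eq_one (h : Λ → Λ → ℂ) (g g' : Λ → Λ → Λ → Λ → ℂ) (hnuc : ℂ) {a b : ℕ}
    (hab : a + b = 1) {ψ : Fock (Orb Λ)} (hψ : IsInSector a b ψ) (hψ1 : star ψ ⬝ᵥ ψ = 1) :
    star ψ ⬝ᵥ molecularHamiltonian h g hnuc *ᵥ ψ = star ψ ⬝ᵥ molecularHamiltonian h g' hnuc *ᵥ ψ := by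
  rw [← rdmEnergy_rdm h g hnuc hψ1, ← rdmEnergy_rdm h g' hnuc hψ1, twoRDM_eq_zero hab hψ hψ1,
    rdmEnergy_two_zero h g g' hnuc]

/-- **The exact ONE-ELECTRON sector energy does not depend on the two-body table**:
`E₀(Ĥ(h, g, h_nuc); a, b) = E₀(Ĥ(h, g′, h_nuc); a, b)` for `a + b = 1` (the Rayleigh sets coincide).
[folklore] -/
theorem sectorGroundEnergy_eq_of_add_eq_one (h : Λ → Λ → ℂ) (g g' : Λ → Λ → Λ → Λ → ℂ) (hnuc : ℂ)
    {a b : ℕ} (hab : a + b = 1) :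
    sectorGroundEnergy (molecularHamiltonian h g hnuc) a b =
      sectorGroundEnergy (molecularHamiltonian h g' hnuc) a b := by
  rw [sectorGroundEnergy_def, sectorGroundEnergy_def, Matrix.minEnergyOn, Matrix.minEnergyOn]
  refine congrArg sInf (Set.ext fun E => ⟨?_, ?_⟩)
  · rintro ⟨ψ, hψ, hψ1, rfl⟩
    exact ⟨ψ, hψ, hψ1, by rw [expect_eq_of_add_eq_one h g g' hnuc hab
      ((mem_szSector_iff_isInSector a b ψ).1 hψ) hψ1]⟩
  · rintro ⟨ψ, hψ, hψ1, rfl⟩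
    exact ⟨ψ, hψ, hψ1, by rw [expect_eq_of_add_eq_one h g g' hnuc hab
      ((mem_szSector_iff_isInSector a b ψ).1 hψ) hψ1]⟩

/-! ## §3 The relaxation is exact in every one-electron sector -/

/-- **`E_PQG(a, b) = E₀(Ĥ; a, b)` FOR `a + b = 1`** (Hermitian `h`, real `h_nuc`, ANY two-body table `g`,
`a, b ≤ |Λ|`): both sides forget `g` (§1, §2) and at `g = 0` the sector programme is exact
(`pqgSectorEnergy_eq_sectorGroundEnergy_oneBody`, the bathtub / Fermi-sum theorem). [folklore] -/
theorem pqgSectorEnergy_eq_sectorGroundEnergy_of_add_eq_one {h : Λ → Λ → ℂ}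
    (g : Λ → Λ → Λ → Λ → ℂ) {hnuc : ℂ} (hh : ∀ p q, star (h p q) = h q p) (hn : star hnuc = hnuc)
    {a b : ℕ} (hab : a + b = 1) (ha : a ≤ Fintype.card Λ) (hb : b ≤ Fintype.card Λ) :
    pqgSectorEnergy h g hnuc a b = sectorGroundEnergy (molecularHamiltonian h g hnuc) a b := by
  rw [pqgSectorEnergy_eq_of_add_eq_one h g 0 hnuc hab, sectorGroundEnergy_eq_of_add_eq_one h g 0 hnuc hab]
  exact pqgSectorEnergy_eq_sectorGroundEnergy_oneBody hh hn ha hb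

end Abstract

end OneElectron

/-! ## §4 The cell's objects: every symmetric model, and the TV-H rings (one electron, one hole) -/

namespace Model

variable {k : ℕ} {F : Model k}

/-- **`E_PQG(a, b) = E₀(H_F; a, b)` FOR THE ONE-ELECTRON SECTORS `(1, 0)`, `(0, 1)` of every symmetric
model** (`k ≥ 1`): the level-DQG value IS the quantity K1 there. [folklore] -/
theorem pqgSectorEnergy_eq_energy_of_add_eq_one (hF : F.IsSymmetric) {a b : ℕ} (hab : a + b = 1)
    (ha : a ≤ k) (hb : b ≤ k) : F.pqgSectorEnergy a b = F.energy a b :=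
  OneElectron.pqgSectorEnergy_eq_sectorGroundEnergy_of_add_eq_one _
    (fun p q => by rw [Complex.star_def, map_ratCast, hF.1 p q]) (by rw [Complex.star_def, map_ratCast])
    hab (by rw [Fintype.card_fin]; exact ha) (by rw [Fintype.card_fin]; exact hb)

end Model

section Ring

variable {L : ℕ}

/-- **On every TV-H ring the level-DQG value is exact in the one-electron sectors**:
`OPT_DQG(L; t, U; 1, 0) = E₀(L; t, U; 1, 0)` and `OPT_DQG(L; t, U; 0, 1) = E₀(L; t, U; 0, 1)` (`L ≥ 1`).
[folklore] -/
theorem hubbardRingTV_pqgSectorEnergy_eq_energy_oneElectron (hL : 1 ≤ L) (t U : ℚ) :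
    Model.pqgSectorEnergy (hubbardRingTV L t U) 1 0 = Model.energy (hubbardRingTV L t U) 1 0 ∧
      Model.pqgSectorEnergy (hubbardRingTV L t U) 0 1 = Model.energy (hubbardRingTV L t U) 0 1 :=
  ⟨Model.pqgSectorEnergy_eq_energy_of_add_eq_one (hubbardRingTV_isSymmetric L t U) rfl hL (Nat.zero_le _),
    Model.pqgSectorEnergy_eq_energy_of_add_eq_one (hubbardRingTV_isSymmetric L t U) rfl (Nat.zero_le _) hL⟩

/-- **… and in the one-HOLE sectors** `(L − 1, L)`, `(L, L − 1)` (`L ≥ 1`, every `t, U`): particle–hole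
duality of the ring (gen 38's `hubbardRingTV_energy_particleHole` / `hubbardRingTV_pqgSectorEnergy_particleHole`,
which carry `(a, b)` at hopping `−t` onto `(L − a, L − b)` at hopping `t` with the same shift on both sides)
transports the one-electron exactness at hopping `−t`. [folklore] -/
theorem hubbardRingTV_pqgSectorEnergy_eq_energy_oneHole (hL : 1 ≤ L) (t U : ℚ) :
    Model.pqgSectorEnergy (hubbardRingTV L t U) (L - 1) L = Model.energy (hubbardRingTV L t U) (L - 1) L ∧
      Model.pqgSectorEnergy (hubbardRingTV L t U) L (L - 1) = Model.energy (hubbardRingTV L t U) L (L - 1) := by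
  obtain ⟨h10, h01⟩ := hubbardRingTV_pqgSectorEnergy_eq_energy_oneElectron hL (-t) U
  have e1 := hubbardRingTV_energy_particleHole (L := L) (-t) U hL (Nat.zero_le L)
  have p1 := hubbardRingTV_pqgSectorEnergy_particleHole (L := L) (-t) U hL (Nat.zero_le L)
  have e2 := hubbardRingTV_energy_particleHole (L := L) (-t) U (Nat.zero_le L) hL
  have p2 := hubbardRingTV_pqgSectorEnergy_particleHole (L := L) (-t) U (Nat.zero_le L) hL
  rw [neg_neg, Nat.sub_zero] at e1 p1 e2 p2
  exact ⟨by rw [p1, e1, h10], by rw [p2, e2, h01]⟩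

end Ring

end Summit.Ventures.CertifiedQuantumChemistry

end
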